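import Mathlib
import Literature.Analysis.FluidPDE.ClassicalSpeedBoundIncrements
import Summits.NavierStokesRegularity.NavierStokesRegularity.Theorems.LevelSetModerationHighSpeedPressureWorkEarlyWindow
import Summits.NavierStokesRegularity.NavierStokesRegularity.Theorems.LevelSetModerationHighSpeedPressureWorkIsoSpeedAreaOfCrux

/-!
# Route LevelSetModeration — crux 2 `HighSpeedPressureWork`: a class-uniform speed bound implies the laws

Proof file for item stmt-NavierStokesRegularity-18149 (`HighSpeedPressureWork`): the CONVERSE direction of
the closures. If the data class `(ν, T, E₀, B₀)` carries a class-uniform a priori speed bound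
`‖u‖ ≤ G(E₀,B₀)` on `[0, T) × ℝ³`, then above the Kato level `2B₀` the level-set laws of the route hold
with exponent `0` and an explicit modulus:

* `levelSetModeration_viscousLaw_of_speedBound` — `ν² D_c(T) ≤ C² G'⁴ V_c(T)` for `c ≥ 2B₀`,
  `G' = max (G E₀ B₀) (2B₀)` (the fast set `{|u| > c}` lies after the early window `c₀ν/B₀²`,
  `levelSetModeration_earlyWindow`, where the quantitative gradient bound
  `exists_norm_fderiv_le_of_speed_le_delay` (delay `c₀`) gives `|∇|u|| ≤ |∇u| ≤ C G'²/ν`);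
* `levelSetModeration_areaLaw_of_speedBound` — `ν 𝒟¹_c(T) ≤ C G'² V_c(T)` for `c ≥ 2B₀`
  (Cauchy–Schwarz `levelSetModeration_isoSpeedArea_le_sqrt`).

So, modulo the level threshold (`M ≥ 4B₀` instead of `2B₀`), the viscous law L1(i), the iso-speed area law
and class-uniform boundedness are EQUIVALENT (`levelSetModeration_areaLawClosure` for the other direction):
the open content of the crux is class-uniform boundedness — quantitative regularity of the data class —
plus the bounded bookkeeping L3.
-/

noncomputable section

-- single-conjunct summit: `Summit.<Summit>.<Problem>` repeats the name by the D-0017 layout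
set_option linter.dupNamespace false

namespace Summit.NavierStokesRegularity.NavierStokesRegularity.Theorems

open MeasureTheory Set Filter Topology Function Metric
open scoped ENNReal NNReal
open Literature.Analysis.FluidPDE

/-- **A class-uniform speed bound implies the viscous level-set law above the Kato level.** There is an
absolute constant `C` such that: for `ν, T > 0`, a classical solution on `ℝ³ × [0,T)` that is Leray–Hopf
from a rapidly decaying datum with `|u₀| ≤ B₀` (`B₀ > 0`) and bounded by `G` on `[0, T) × ℝ³`, and every
level `c ≥ 2B₀`: `ν² D_c(T) ≤ C (max G (2B₀))⁴ V_c(T)` (extended reals). The fast set `{|u| > c}` is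
empty before `c₀ν/B₀²` (early window) and carries `|∇|u|| ≤ |∇u| ≤ C' (max G (2B₀))²/ν` afterwards
(quantitative smoothing with delay `c₀`). [folklore] -/
theorem levelSetModeration_viscousLaw_of_speedBound :
    ∃ C : ℝ, 0 < C ∧ ∀ (ν T : ℝ) (u : ℝ → EuclideanSpace ℝ (Fin 3) → EuclideanSpace ℝ (Fin 3))
      (p : ℝ → EuclideanSpace ℝ (Fin 3) → ℝ), 0 < ν → 0 < T →
      IsClassicalNSSolutionOn (Ico 0 T) ν 0 u p → IsLerayHopfOn T ν 0 (u 0) u →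
      HasRapidSpatialDecay (u 0) → ∀ (B₀ G : ℝ), 0 < B₀ → (∀ x, ‖u 0 x‖ ≤ B₀) →
      (∀ t ∈ Ico 0 T, ∀ x, ‖u t x‖ ≤ G) → ∀ c : ℝ, 2 * B₀ ≤ c →
      ENNReal.ofReal (ν ^ 2) * (∫⁻ τ in Ioo 0 T, ∫⁻ x, {x | c < ‖u τ x‖}.indicator
          (fun x => ENNReal.ofReal (‖fderiv ℝ (fun y => ‖u τ y‖) x‖ ^ 2)) x) ≤
        ENNReal.ofReal (C * (max G (2 * B₀)) ^ 4) * ∫⁻ τ in Ioo 0 T, volume {x | c < ‖u τ x‖} := by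
  obtain ⟨c₀, hc₀, hW⟩ := levelSetModeration_earlyWindow
  obtain ⟨Cg, hCg⟩ := exists_norm_fderiv_le_of_speed_le_delay (d := c₀) hc₀
  set C' : ℝ := max Cg 1 with hC'
  have hC'pos : 0 < C' := lt_of_lt_of_le one_pos (le_max_right _ _)
  refine ⟨C' ^ 2, by positivity, ?_⟩
  intro ν T u p hν hT hcl hLH hdec B₀ G hB₀ hbd0 hbd c hc
  set G' : ℝ := max G (2 * B₀) with hG'
  have hG'pos : 0 < G' := lt_of_lt_of_le (by positivity) (le_max_right _ _)
  have hG'B : 2 * B₀ ≤ G' := le_max_right _ _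
  have hbd' : ∀ t ∈ Ico 0 T, ∀ x, ‖u t x‖ ≤ G' := fun t ht x => (hbd t ht x).trans (le_max_left _ _)
  -- uniform `L²` bound of the slices
  set K : ℝ≥0∞ := (ENNReal.ofReal (∫ x, ‖u 0 x‖ ^ 2)) ^ (1 / 2 : ℝ) with hK
  have hKtop : K ≠ ∞ := ENNReal.rpow_ne_top_of_nonneg (by norm_num) ENNReal.ofReal_ne_top
  have hL2 : ∀ t ∈ Icc 0 T, t < T → eLpNorm (u t) 2 volume ≤ K := by
    intro t ht _
    have h := lintegral_enorm_sq_le_of_lerayHopf hLH hν.le ht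
    rw [eLpNorm_eq_lintegral_rpow_enorm_toReal (by norm_num) (by norm_num), ENNReal.toReal_ofNat, hK]
    refine ENNReal.rpow_le_rpow ?_ (by norm_num)
    refine le_trans (le_of_eq ?_) h
    exact lintegral_congr fun x => by rw [ENNReal.rpow_two]
  -- pointwise bound of the integrand on the fast set
  set L : ℝ := C' * G' ^ 2 / ν with hL
  have hLpos : 0 < L := by rw [hL]; positivity
  have hslice : ∀ τ ∈ Ioo 0 T, (∫⁻ x, {x | c < ‖u τ x‖}.indicator
      (fun x => ENNReal.ofReal (‖fderiv ℝ (fun y => ‖u τ y‖) x‖ ^ 2)) x) ≤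
      ENNReal.ofReal (L ^ 2) * volume {x | c < ‖u τ x‖} := by
    intro τ hτ
    have hτ' : τ ∈ Ico 0 T := ⟨hτ.1.le, hτ.2⟩
    have hA : MeasurableSet {x | c < ‖u τ x‖} :=
      (isOpen_lt continuous_const (hcl.contDiff_velocity hτ').continuous.norm).measurableSet
    rw [← lintegral_indicator_const hA]
    refine lintegral_mono fun x => ?_
    by_cases hx : x ∈ {x | c < ‖u τ x‖}
    · rw [indicator_of_mem hx, indicator_of_mem hx]
      -- `τ` is after the early window
      have hlate : c₀ * ν / B₀ ^ 2 ≤ τ := by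
        by_contra hlt
        rw [not_le] at hlt
        have hempty := (hW ν T u p hν hT hcl hLH hdec B₀ hB₀ hbd0 τ hτ' hlt).2 c hc
        rw [hempty] at hx
        exact hx
      -- hence after the delay `c₀ ν / G'²`
      have hdelay : c₀ * ν / G' ^ 2 < τ := by
        have h1 : c₀ * ν / G' ^ 2 < c₀ * ν / B₀ ^ 2 := by
          apply div_lt_div_of_pos_left (by positivity) (by positivity)
          nlinarith
        exact h1.trans_le hlate
      -- the gradient bound at `τ` on the horizon `T'' = (τ + T)/2`
      set T'' : ℝ := (τ + T) / 2 with hT''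
      have hT''pos : 0 < T'' := by rw [hT'']; linarith [hτ.1]
      have hT''T : T'' < T := by rw [hT'']; linarith [hτ.2]
      have hτT'' : τ < T'' := by rw [hT'']; linarith [hτ.2]
      have hbd'' : ∀ t ∈ Icc 0 T'', ∀ y, ‖u t y‖ ≤ G' := fun t ht y => hbd' t ⟨ht.1, ht.2.trans_lt hT''T⟩ y
      have hgrad := hCg hν hG'pos hcl hT''pos hT''T hbd'' hKtop
        (fun t ht => hL2 t ⟨ht.1, ht.2.trans hT''T.le⟩ (ht.2.trans_lt hT''T)) τ ⟨hdelay, hτT''⟩ x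
      have hx0 : u τ x ≠ 0 := by
        intro h0
        have : c < ‖u τ x‖ := hx
        rw [h0, norm_zero] at this
        linarith
      have hspeed := norm_fderiv_norm_comp_le ((hcl.contDiff_velocity hτ').differentiable (by simp) x) hx0
      have hle : ‖fderiv ℝ (fun y => ‖u τ y‖) x‖ ≤ L := by
        refine hspeed.trans (hgrad.trans ?_)
        rw [hL]
        exact div_le_div_of_nonneg_right (mul_le_mul_of_nonneg_right (le_max_left _ _) (sq_nonneg _)) hν.le
      exact ENNReal.ofReal_le_ofReal (pow_le_pow_left₀ (norm_nonneg _) hle 2)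
    · rw [indicator_of_notMem hx, indicator_of_notMem hx]
  -- integrate in time
  have hint : (∫⁻ τ in Ioo 0 T, ∫⁻ x, {x | c < ‖u τ x‖}.indicator
      (fun x => ENNReal.ofReal (‖fderiv ℝ (fun y => ‖u τ y‖) x‖ ^ 2)) x) ≤
      ENNReal.ofReal (L ^ 2) * ∫⁻ τ in Ioo 0 T, volume {x | c < ‖u τ x‖} := by
    rw [← lintegral_const_mul' _ _ ENNReal.ofReal_ne_top]
    exact setLIntegral_mono' measurableSet_Ioo fun τ hτ => hslice τ hτ
  calc ENNReal.ofReal (ν ^ 2) * (∫⁻ τ in Ioo 0 T, ∫⁻ x, {x | c < ‖u τ x‖}.indicator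
        (fun x => ENNReal.ofReal (‖fderiv ℝ (fun y => ‖u τ y‖) x‖ ^ 2)) x)
      ≤ ENNReal.ofReal (ν ^ 2) * (ENNReal.ofReal (L ^ 2) * ∫⁻ τ in Ioo 0 T, volume {x | c < ‖u τ x‖}) :=
        mul_le_mul' le_rfl hint
    _ = ENNReal.ofReal (C' ^ 2 * G' ^ 4) * ∫⁻ τ in Ioo 0 T, volume {x | c < ‖u τ x‖} := by
        rw [← mul_assoc, ← ENNReal.ofReal_mul (sq_nonneg ν)]
        congr 2
        rw [hL]
        field_simp

/-- **A class-uniform speed bound implies the iso-speed AREA LAW above the Kato level**: with the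
constant `C` of `levelSetModeration_viscousLaw_of_speedBound`, `ν 𝒟¹_c(T) ≤ √C (max G (2B₀))² V_c(T)`
for `c ≥ 2B₀` (Cauchy–Schwarz `levelSetModeration_isoSpeedArea_le_sqrt`). [folklore] -/
theorem levelSetModeration_areaLaw_of_speedBound :
    ∃ C : ℝ, 0 < C ∧ ∀ (ν T : ℝ) (u : ℝ → EuclideanSpace ℝ (Fin 3) → EuclideanSpace ℝ (Fin 3))
      (p : ℝ → EuclideanSpace ℝ (Fin 3) → ℝ), 0 < ν → 0 < T →
      IsClassicalNSSolutionOn (Ico 0 T) ν 0 u p → IsLerayHopfOn T ν 0 (u 0) u →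
      HasRapidSpatialDecay (u 0) → ∀ (B₀ G : ℝ), 0 < B₀ → (∀ x, ‖u 0 x‖ ≤ B₀) →
      (∀ t ∈ Ico 0 T, ∀ x, ‖u t x‖ ≤ G) → ∀ c : ℝ, 2 * B₀ ≤ c →
      ENNReal.ofReal ν * (∫⁻ τ in Ioo 0 T, ∫⁻ x, {x | c < ‖u τ x‖}.indicator
          (fun x => ENNReal.ofReal ‖fderiv ℝ (fun y => ‖u τ y‖) x‖) x) ≤
        ENNReal.ofReal (C * (max G (2 * B₀)) ^ 2) * ∫⁻ τ in Ioo 0 T, volume {x | c < ‖u τ x‖} := by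
  obtain ⟨C, hC, hV⟩ := levelSetModeration_viscousLaw_of_speedBound
  refine ⟨Real.sqrt C, Real.sqrt_pos.2 hC, ?_⟩
  intro ν T u p hν hT hcl hLH hdec B₀ G hB₀ hbd0 hbd c hc
  have hcpos : 0 < c := by linarith
  set V : ℝ≥0∞ := ∫⁻ τ in Ioo 0 T, volume {x | c < ‖u τ x‖} with hVdef
  set D : ℝ≥0∞ := ∫⁻ τ in Ioo 0 T, ∫⁻ x, {x | c < ‖u τ x‖}.indicator
    (fun x => ENNReal.ofReal (‖fderiv ℝ (fun y => ‖u τ y‖) x‖ ^ 2)) x with hDdef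
  have hlaw := hV ν T u p hν hT hcl hLH hdec B₀ G hB₀ hbd0 hbd c hc
  have hCS := levelSetModeration_isoSpeedArea_le_sqrt hcl.smooth_velocity hcpos (T := T)
  set G' : ℝ := max G (2 * B₀) with hG'
  have hG'0 : 0 ≤ G' := le_trans (by positivity) (le_max_right _ _)
  -- `ofReal ν * D^{1/2} ≤ ofReal (√C G'²) V^{1/2}` from the viscous law by taking square roots
  have hsq : ENNReal.ofReal ν * D ^ (1 / 2 : ℝ) ≤ ENNReal.ofReal (Real.sqrt C * G' ^ 2) * V ^ (1 / 2 : ℝ) := by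
    have h1 : (ENNReal.ofReal (ν ^ 2) * D) ^ (1 / 2 : ℝ) ≤
        (ENNReal.ofReal (C * G' ^ 4) * V) ^ (1 / 2 : ℝ) := ENNReal.rpow_le_rpow hlaw (by norm_num)
    rw [ENNReal.mul_rpow_of_nonneg _ _ (by norm_num), ENNReal.mul_rpow_of_nonneg _ _ (by norm_num),
      ENNReal.ofReal_rpow_of_nonneg (sq_nonneg ν) (by norm_num),
      ENNReal.ofReal_rpow_of_nonneg (by positivity) (by norm_num)] at h1
    have e1 : (ν ^ 2) ^ (1 / 2 : ℝ) = ν := by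
      rw [← Real.sqrt_eq_rpow, Real.sqrt_sq hν.le]
    have e2 : (C * G' ^ 4) ^ (1 / 2 : ℝ) = Real.sqrt C * G' ^ 2 := by
      rw [← Real.sqrt_eq_rpow, Real.sqrt_mul hC.le, show G' ^ 4 = (G' ^ 2) ^ 2 by ring,
        Real.sqrt_sq (sq_nonneg _)]
    rwa [e1, e2] at h1
  calc ENNReal.ofReal ν * (∫⁻ τ in Ioo 0 T, ∫⁻ x, {x | c < ‖u τ x‖}.indicator
        (fun x => ENNReal.ofReal ‖fderiv ℝ (fun y => ‖u τ y‖) x‖) x)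
      ≤ ENNReal.ofReal ν * (V ^ (1 / 2 : ℝ) * D ^ (1 / 2 : ℝ)) := mul_le_mul' le_rfl hCS
    _ = (ENNReal.ofReal ν * D ^ (1 / 2 : ℝ)) * V ^ (1 / 2 : ℝ) := by ring
    _ ≤ (ENNReal.ofReal (Real.sqrt C * G' ^ 2) * V ^ (1 / 2 : ℝ)) * V ^ (1 / 2 : ℝ) :=
        mul_le_mul' hsq le_rfl
    _ = ENNReal.ofReal (Real.sqrt C * G' ^ 2) * V := by
        rw [mul_assoc, ← ENNReal.rpow_add_of_nonneg _ _ (by norm_num) (by norm_num)]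
        norm_num

end Summit.NavierStokesRegularity.NavierStokesRegularity.Theorems

end
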